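import Literature.Analysis.Asymptotics.LinearRecurrenceDominantRoot
import HarnessLib

/-!
# Complex linear recurrences: quantitative deflation, the dominant simple root, and stability of root bounds

`Literature/Analysis/Asymptotics/LinearRecurrenceDeflation.lean` and `…/LinearRecurrenceDominantRoot.lean` give EXPLICIT two-term asymptotics for
REAL sequences obeying a second/third-order linear recurrence whose characteristic polynomial has a dominant simple (positive) root — the model-free
input of the lane's uniform two-term asymptotics of strip partition functions at REAL fugacities.  The Berry–Esseen / local-limit programme for the
same statistics needs the partition function at COMPLEX fugacity `y e^{iθ/√N}`: the coefficients become complex, the recurrences keep their shape,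
and the dominant root `s` moves off the positive axis but stays dominant in modulus for small `θ`.  THIS FILE is the complex port, with the same
explicit constants (so that uniformity in a complex parameter is again a matter of suprema), plus the stability lemma that carries the spectral gap
from the real point to a complex neighbourhood:

* §1 `norm_root_le_of_quadratic` — every root of `σ² + pσ + κ` (`p, κ ∈ ℂ`) has `‖σ‖ ≤ (‖p‖ + √(‖p‖² + 4‖κ‖))/2`;
  ★ `norm_root_le_of_near` — STABILITY: if all roots of `σ² + p₀σ + κ₀` have modulus `≤ R₀ < R'` and
  `‖p − p₀‖(R' + 1) + ‖κ − κ₀‖ ≤ (R' − R₀)²`... precisely `‖p − p₀‖ * R' + ‖κ − κ₀‖ < (R' − R₀)^2`, then all roots of `σ² + pσ + κ` have modulus `≤ R'`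
  (no continuity-of-roots theorem needed).
* §2 ★★ `norm_le_of_rec_two_complex` — `w_{n+2} = −p w_{n+1} − κ w_n` (complex), roots of modulus `≤ R` ⇒
  `‖w_{n+1}‖ ≤ R^{n+1}‖w₀‖ + (n+1)Rⁿ(‖w₁‖ + R‖w₀‖)`.
* §3 ★★ `exists_tendsto_norm_sub_le_of_rec_three_complex` — `b_{n+3} = A b_{n+2} + B b_{n+1} + C b_n` (complex) with
  `t³ − At² − Bt − C = (t − s)(t² + pt + κ)`, `0 < R < ‖s‖`, cofactor roots of modulus `≤ R` ⇒ `b_n/sⁿ → L ∈ ℂ` and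
  `‖b_n − L sⁿ‖ ≤ (‖b₁ − s b₀‖ + ‖b₂ − s b₁‖/R)(n+1)Rⁿ‖s‖/(‖s‖ − R)²` for EVERY `n`.
* §4 `norm_le_of_rec_two_double_root_complex` (`f_{n+2} = 2w f_{n+1} − w² f_n`, `w ∈ ℂ ∖ {0}`).

## Sources
R. P. Stanley, *Enumerative Combinatorics* 1 (2nd ed. 2012) §4.1 Theorem 4.1.1 (iii) (coefficients of rational functions are exponential polynomials;
the poles of smallest modulus dominate) — here quantitative with explicit constants, complex data; lane arrangement (lane «pcv-sawmu», a-p5 g27).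
Nothing is quoted AS PRINTED.
-/

noncomputable section

open Filter Finset
open scoped Topology

namespace Literature.Analysis.Asymptotics

/-! ## §1 Root bounds for a complex monic quadratic and their stability -/

/-- Every root `σ` of `σ² + pσ + κ = 0` (`p, κ ∈ ℂ`) satisfies `‖σ‖ ≤ (‖p‖ + √(‖p‖² + 4‖κ‖))/2` (from `‖σ‖² ≤ ‖p‖‖σ‖ + ‖κ‖`).
[cite: Stanley2012EC1, §4.1 Theorem 4.1.1 (iii) (lane tool)] -/
theorem norm_root_le_of_quadratic {p κ σ : ℂ} (hσ : σ ^ 2 + p * σ + κ = 0) :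
    ‖σ‖ ≤ (‖p‖ + Real.sqrt (‖p‖ ^ 2 + 4 * ‖κ‖)) / 2 := by
  have h1 : σ ^ 2 = -(p * σ + κ) := by linear_combination hσ
  have h2 : ‖σ‖ ^ 2 ≤ ‖p‖ * ‖σ‖ + ‖κ‖ := by
    calc ‖σ‖ ^ 2 = ‖σ ^ 2‖ := (norm_pow σ 2).symm
      _ = ‖p * σ + κ‖ := by rw [h1, norm_neg]
      _ ≤ ‖p * σ‖ + ‖κ‖ := norm_add_le _ _
      _ = ‖p‖ * ‖σ‖ + ‖κ‖ := by rw [norm_mul]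
  set D := Real.sqrt (‖p‖ ^ 2 + 4 * ‖κ‖) with hD
  have hD0 : 0 ≤ D := Real.sqrt_nonneg _
  have hD2 : D ^ 2 = ‖p‖ ^ 2 + 4 * ‖κ‖ := Real.sq_sqrt (by positivity)
  -- `‖σ‖` lies below the positive root of `x² − ‖p‖x − ‖κ‖`
  by_contra! hlt
  have hx : (‖p‖ + D) / 2 < ‖σ‖ := hlt
  have hpos : 0 < ‖σ‖ - (‖p‖ + D) / 2 := by linarith
  have key : (‖σ‖ - (‖p‖ + D) / 2) * (‖σ‖ - (‖p‖ - D) / 2) = ‖σ‖ ^ 2 - ‖p‖ * ‖σ‖ - ‖κ‖ := by nlinarith [hD2]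
  have h3 : 0 < ‖σ‖ - (‖p‖ - D) / 2 := by linarith
  have h4 : 0 < ‖σ‖ ^ 2 - ‖p‖ * ‖σ‖ - ‖κ‖ := by rw [← key]; exact mul_pos hpos h3
  linarith

/-- ★ **Stability of a root bound (the spectral gap survives a small complex perturbation).**  If every root of `σ² + p₀σ + κ₀` has modulus
`≤ R₀`, `R₀ < R'`, and `‖p − p₀‖·R' + ‖κ − κ₀‖ < (R' − R₀)²`, then every root of `σ² + pσ + κ` has modulus `≤ R'`.  (At a root `σ` with
`‖σ‖ > R'`: `|σ² + p₀σ + κ₀| = |σ − σ₁||σ − σ₂| ≥ (‖σ‖ − R₀)²` while `= |(p₀ − p)σ + (κ₀ − κ)| ≤ ‖p − p₀‖‖σ‖ + ‖κ − κ₀‖`, and the ratio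
`(‖σ‖ − R₀)²/‖σ‖` is increasing in `‖σ‖ ≥ R'`.) [cite: Stanley2012EC1, §4.1 Theorem 4.1.1 (iii) (lane tool: perturbative pole location)] -/
theorem norm_root_le_of_near {p₀ κ₀ p κ : ℂ} {R₀ R' : ℝ} (hR0 : 0 ≤ R₀) (hR : R₀ < R')
    (hroot : ∀ σ : ℂ, σ ^ 2 + p₀ * σ + κ₀ = 0 → ‖σ‖ ≤ R₀)
    (hnear : ‖p - p₀‖ * R' + ‖κ - κ₀‖ < (R' - R₀) ^ 2) {σ : ℂ} (hσ : σ ^ 2 + p * σ + κ = 0) : ‖σ‖ ≤ R' := by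
  -- factor the unperturbed quadratic over `ℂ`
  obtain ⟨c, hc⟩ := IsAlgClosed.exists_pow_nat_eq (p₀ ^ 2 - 4 * κ₀) (by norm_num : 0 < 2)
  set σ₁ : ℂ := (-p₀ + c) / 2 with hσ₁
  set σ₂ : ℂ := (-p₀ - c) / 2 with hσ₂
  have hsum : σ₁ + σ₂ = -p₀ := by rw [hσ₁, hσ₂]; ring
  have hprod : σ₁ * σ₂ = κ₀ := by rw [hσ₁, hσ₂]; linear_combination (-1 / 4 : ℂ) * hc
  have hq1 : σ₁ ^ 2 + p₀ * σ₁ + κ₀ = 0 := by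
    rw [← hprod, show p₀ = -(σ₁ + σ₂) by rw [hsum]; ring]; ring
  have hq2 : σ₂ ^ 2 + p₀ * σ₂ + κ₀ = 0 := by
    rw [← hprod, show p₀ = -(σ₁ + σ₂) by rw [hsum]; ring]; ring
  have hn1 := hroot σ₁ hq1
  have hn2 := hroot σ₂ hq2
  have hfac : σ ^ 2 + p₀ * σ + κ₀ = (σ - σ₁) * (σ - σ₂) := by
    rw [← hprod, show p₀ = -(σ₁ + σ₂) by rw [hsum]; ring]; ring
  by_contra! hlt
  have hσpos : 0 < ‖σ‖ := lt_of_le_of_lt (by linarith) hlt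
  -- lower bound `(‖σ‖ − R₀)² ≤ |σ² + p₀σ + κ₀|`
  have hlow : (‖σ‖ - R₀) ^ 2 ≤ ‖σ ^ 2 + p₀ * σ + κ₀‖ := by
    rw [hfac, norm_mul]
    have h1 : ‖σ‖ - R₀ ≤ ‖σ - σ₁‖ := by linarith [norm_sub_norm_le σ σ₁]
    have h2 : ‖σ‖ - R₀ ≤ ‖σ - σ₂‖ := by linarith [norm_sub_norm_le σ σ₂]
    have h0 : 0 ≤ ‖σ‖ - R₀ := by linarith
    rw [sq]
    exact mul_le_mul h1 h2 h0 (norm_nonneg _)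
  -- upper bound from the perturbed equation
  have hup : ‖σ ^ 2 + p₀ * σ + κ₀‖ ≤ ‖p - p₀‖ * ‖σ‖ + ‖κ - κ₀‖ := by
    have e : σ ^ 2 + p₀ * σ + κ₀ = -((p - p₀) * σ + (κ - κ₀)) := by linear_combination hσ
    rw [e, norm_neg]
    exact (norm_add_le _ _).trans (by rw [norm_mul])
  -- but `(‖σ‖ − R₀)² > ‖p − p₀‖‖σ‖ + ‖κ − κ₀‖` for `‖σ‖ > R'` (monotonicity from `R'`)
  have hmono : (R' - R₀) ^ 2 * ‖σ‖ ≤ (‖σ‖ - R₀) ^ 2 * R' := by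
    have h1 : 0 ≤ ‖σ‖ - R' := by linarith
    have h2 : 0 ≤ R' * ‖σ‖ - R₀ ^ 2 := by nlinarith
    nlinarith [mul_nonneg h1 h2]
  have hA : (‖p - p₀‖ * ‖σ‖ + ‖κ - κ₀‖) * R' < (R' - R₀) ^ 2 * ‖σ‖ := by
    have hR'0 : 0 < R' := lt_of_le_of_lt hR0 hR
    have hκ : ‖κ - κ₀‖ * R' ≤ ‖κ - κ₀‖ * ‖σ‖ := mul_le_mul_of_nonneg_left hlt.le (norm_nonneg _)
    nlinarith [mul_lt_mul_of_pos_right hnear hσpos, norm_nonneg (p - p₀), norm_nonneg (κ - κ₀)]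
  have hR'0 : 0 < R' := lt_of_le_of_lt hR0 hR
  have : (‖σ‖ - R₀) ^ 2 * R' ≤ (‖p - p₀‖ * ‖σ‖ + ‖κ - κ₀‖) * R' :=
    mul_le_mul_of_nonneg_right (hlow.trans hup) hR'0.le
  linarith

/-! ## §2 ★★ Quantitative deflation for a complex second-order recurrence -/

/-- ★★ **Quantitative deflation, complex form**: if every root `σ` of `σ² + pσ + κ` (`p, κ ∈ ℂ`) has `‖σ‖ ≤ R` and the complex sequence `w`
satisfies `w_{n+2} = −p w_{n+1} − κ w_n`, then `‖w_{n+1}‖ ≤ R^{n+1}‖w₀‖ + (n+1) Rⁿ (‖w₁‖ + R‖w₀‖)` for every `n` (`g_n = w_{n+1} − σ₁w_n`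
satisfies `g_{n+1} = σ₂ g_n`; no case distinction at a double root). [cite: Stanley2012EC1, §4.1 Theorem 4.1.1 (iii) (lane statement, explicit constants)] -/
theorem norm_le_of_rec_two_complex {p κ : ℂ} {R : ℝ} (hR0 : 0 ≤ R) (hR : ∀ σ : ℂ, σ ^ 2 + p * σ + κ = 0 → ‖σ‖ ≤ R) {w : ℕ → ℂ}
    (hw : ∀ n, w (n + 2) = -p * w (n + 1) - κ * w n) (n : ℕ) :
    ‖w (n + 1)‖ ≤ R ^ (n + 1) * ‖w 0‖ + ((n : ℝ) + 1) * R ^ n * (‖w 1‖ + R * ‖w 0‖) := by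
  obtain ⟨c, hc⟩ := IsAlgClosed.exists_pow_nat_eq (p ^ 2 - 4 * κ) (by norm_num : 0 < 2)
  set σ₁ : ℂ := (-p + c) / 2 with hσ₁
  set σ₂ : ℂ := (-p - c) / 2 with hσ₂
  have hsum : σ₂ = -p - σ₁ := by rw [hσ₁, hσ₂]; ring
  have hprod : σ₁ * σ₂ = κ := by
    rw [hσ₁, hσ₂]; linear_combination (-1 / 4 : ℂ) * hc
  have hq1 : σ₁ ^ 2 + p * σ₁ + κ = 0 := by rw [← hprod, hsum]; ring
  have hq2 : σ₂ ^ 2 + p * σ₂ + κ = 0 := by rw [← hprod, hsum]; ring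
  have hn1 := hR σ₁ hq1
  have hn2 := hR σ₂ hq2
  set g : ℕ → ℂ := fun n => w (n + 1) - σ₁ * w n with hg
  have hgrec : ∀ n, g (n + 1) = σ₂ * g n := by
    intro n
    simp only [hg]
    rw [show n + 1 + 1 = n + 2 by omega, hw n, hsum]
    linear_combination (-(w n)) * hprod - (w n / 2) * hc
  have hgn : ∀ n, g n = σ₂ ^ n * g 0 := by
    intro n
    induction n with
    | zero => simp
    | succ n ih => rw [hgrec, ih]; ring
  have hg0 : ‖g 0‖ ≤ ‖w 1‖ + R * ‖w 0‖ := by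
    have e : g 0 = w 1 - σ₁ * w 0 := rfl
    rw [e]
    calc ‖w 1 - σ₁ * w 0‖ ≤ ‖w 1‖ + ‖σ₁ * w 0‖ := norm_sub_le _ _
      _ = ‖w 1‖ + ‖σ₁‖ * ‖w 0‖ := by rw [norm_mul]
      _ ≤ ‖w 1‖ + R * ‖w 0‖ := by
          have := mul_le_mul_of_nonneg_right hn1 (norm_nonneg (w 0)); linarith
  have hbound : ∀ n : ℕ, ‖w (n + 1)‖ ≤ R ^ (n + 1) * ‖w 0‖ + ((n : ℝ) + 1) * R ^ n * ‖g 0‖ := by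
    intro n
    induction n with
    | zero =>
      have e : w (0 + 1) = σ₁ * w 0 + g 0 := by simp only [hg]; ring
      rw [e]
      simp only [zero_add, pow_one, pow_zero, Nat.cast_zero, one_mul, mul_one]
      calc ‖σ₁ * w 0 + g 0‖ ≤ ‖σ₁ * w 0‖ + ‖g 0‖ := norm_add_le _ _
        _ = ‖σ₁‖ * ‖w 0‖ + ‖g 0‖ := by rw [norm_mul]
        _ ≤ R * ‖w 0‖ + ‖g 0‖ := by
          have h0 : 0 ≤ ‖w 0‖ := norm_nonneg _
          nlinarith
    | succ n ih =>
      have e : w (n + 1 + 1) = σ₁ * w (n + 1) + g (n + 1) := by simp only [hg]; ring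
      rw [e]
      have hgnorm : ‖g (n + 1)‖ ≤ R ^ (n + 1) * ‖g 0‖ := by
        rw [hgn (n + 1), norm_mul, norm_pow]
        exact mul_le_mul_of_nonneg_right (pow_le_pow_left₀ (norm_nonneg _) hn2 _) (norm_nonneg _)
      calc ‖σ₁ * w (n + 1) + g (n + 1)‖ ≤ ‖σ₁‖ * ‖w (n + 1)‖ + ‖g (n + 1)‖ := by
            rw [← norm_mul]; exact norm_add_le _ _
        _ ≤ R * (R ^ (n + 1) * ‖w 0‖ + (n + 1) * R ^ n * ‖g 0‖) + R ^ (n + 1) * ‖g 0‖ := by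
            have h2 : 0 ≤ ‖w (n + 1)‖ := norm_nonneg _
            nlinarith [norm_nonneg σ₁]
        _ = R ^ (n + 1 + 1) * ‖w 0‖ + ((n + 1 : ℕ) + 1 : ℝ) * R ^ (n + 1) * ‖g 0‖ := by
            push_cast; ring
  have h := hbound n
  have hpos : 0 ≤ ((n : ℝ) + 1) * R ^ n := by positivity
  calc ‖w (n + 1)‖ ≤ R ^ (n + 1) * ‖w 0‖ + ((n : ℝ) + 1) * R ^ n * ‖g 0‖ := h
    _ ≤ R ^ (n + 1) * ‖w 0‖ + ((n : ℝ) + 1) * R ^ n * (‖w 1‖ + R * ‖w 0‖) := by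
        have := mul_le_mul_of_nonneg_left hg0 hpos; linarith

/-! ## §3 ★★ The dominant simple root of a complex cubic recurrence -/

/-- ★★ **Two-term asymptotics with explicit constants, complex form.**  Let `b_{n+3} = A b_{n+2} + B b_{n+1} + C b_n` be a COMPLEX sequence with
`t³ − At² − Bt − C = (t − s)(t² + pt + κ)` (`A = s − p`, `B = ps − κ`, `C = κs`), and suppose every root of `σ² + pσ + κ` has modulus `≤ R` with
`0 < R < ‖s‖`.  Then `b_n/sⁿ → L` for some `L ∈ ℂ` and, for EVERY `n`,
`‖b_n − L·sⁿ‖ ≤ (‖b₁ − s b₀‖ + ‖b₂ − s b₁‖/R) · (n+1) · Rⁿ · ‖s‖/(‖s‖ − R)²`.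
[cite: Stanley2012EC1, §4.1 Theorem 4.1.1 (iii) (lane statement with explicit constants; complex data)] -/
theorem exists_tendsto_norm_sub_le_of_rec_three_complex {A B C s p κ : ℂ} {R : ℝ} (hR0 : 0 < R) (hRs : R < ‖s‖)
    (hA : A = s - p) (hB : B = p * s - κ) (hC : C = κ * s)
    (hroot : ∀ σ : ℂ, σ ^ 2 + p * σ + κ = 0 → ‖σ‖ ≤ R)
    (b : ℕ → ℂ) (hb : ∀ n, b (n + 3) = A * b (n + 2) + B * b (n + 1) + C * b n) :
    ∃ L : ℂ, Tendsto (fun n => b n / s ^ n) atTop (𝓝 L) ∧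
      ∀ n : ℕ, ‖b n - L * s ^ n‖ ≤
        (‖b 1 - s * b 0‖ + ‖b 2 - s * b 1‖ / R) * ((n : ℝ) + 1) * R ^ n * (‖s‖ / (‖s‖ - R) ^ 2) := by
  have hs : 0 < ‖s‖ := hR0.trans hRs
  have hs0 : s ≠ 0 := norm_pos_iff.1 hs
  -- deflation
  set g : ℕ → ℂ := fun n => b (n + 1) - s * b n with hg
  have hgrec : ∀ n, g (n + 2) = -p * g (n + 1) - κ * g n := by
    intro n
    simp only [hg]
    rw [show n + 2 + 1 = n + 3 by ring, hb n, hA, hB, hC]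
    ring
  set Γ : ℝ := ‖g 0‖ + ‖g 1‖ / R with hΓ
  have hΓ0 : 0 ≤ Γ := by positivity
  have hgb : ∀ n, ‖g n‖ ≤ ((n : ℝ) + 1) * R ^ n * Γ := by
    intro n
    cases n with
    | zero =>
      simp only [CharP.cast_eq_zero, zero_add, pow_zero, one_mul, hΓ]
      have : 0 ≤ ‖g 1‖ / R := by positivity
      linarith
    | succ n =>
      have h := norm_le_of_rec_two_complex hR0.le hroot hgrec n
      have hRn : 0 ≤ R ^ n := pow_nonneg hR0.le n
      have hn0 : (0 : ℝ) ≤ n := n.cast_nonneg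
      have e : ((((n + 1 : ℕ) : ℝ)) + 1) * R ^ (n + 1) * Γ
          = (n + 2) * R ^ (n + 1) * ‖g 0‖ + (n + 2) * R ^ n * ‖g 1‖ := by
        rw [hΓ]; push_cast; field_simp; ring
      rw [e]
      calc ‖g (n + 1)‖ ≤ R ^ (n + 1) * ‖g 0‖ + ((n : ℝ) + 1) * R ^ n * (‖g 1‖ + R * ‖g 0‖) := h
        _ ≤ (n + 2) * R ^ (n + 1) * ‖g 0‖ + (n + 2) * R ^ n * ‖g 1‖ := by
          rw [pow_succ]
          nlinarith [norm_nonneg (g 0), norm_nonneg (g 1), mul_nonneg hRn (norm_nonneg (g 1)),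
            mul_nonneg (mul_nonneg hRn hR0.le) (norm_nonneg (g 0))]
  -- telescoping
  set f : ℕ → ℂ := fun k => g k / s ^ (k + 1) with hf
  have htel : ∀ n, b n / s ^ n = b 0 + ∑ k ∈ range n, f k := by
    intro n
    induction n with
    | zero => simp
    | succ n ih =>
      rw [sum_range_succ, ← add_assoc, ← ih]
      simp only [hf, hg]
      field_simp
      ring
  -- domination `‖f k‖ ≤ (Γ/‖s‖)(k+1)θ^k`, `θ = R/‖s‖`
  set θ : ℝ := R / ‖s‖ with hθ
  have hθ0 : 0 ≤ θ := by positivity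
  have hθ1 : θ < 1 := by rw [hθ, div_lt_one hs]; exact hRs
  have hdom : ∀ k, ‖f k‖ ≤ Γ / ‖s‖ * ((((k : ℕ) : ℝ) + 1) * θ ^ k) := by
    intro k
    simp only [hf]
    rw [norm_div, norm_pow]
    have hk := hgb k
    have e : Γ / ‖s‖ * (((k : ℝ) + 1) * θ ^ k) = ((k : ℝ) + 1) * R ^ k * Γ / ‖s‖ ^ (k + 1) := by
      rw [hθ, div_pow, pow_succ]; field_simp
    rw [e]
    exact div_le_div_of_nonneg_right hk (pow_pos hs _).le
  have hsumdom : Summable (fun k : ℕ => Γ / ‖s‖ * ((((k : ℕ) : ℝ) + 1) * θ ^ k)) :=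
    (Literature.Analysis.summable_coe_add_one_mul_geometric hθ0 hθ1).mul_left _
  have hsf : Summable f := Summable.of_norm_bounded hsumdom hdom
  set L : ℂ := b 0 + ∑' k, f k with hL
  refine ⟨L, ?_, ?_⟩
  · have h := hsf.hasSum.tendsto_sum_nat
    have h' : Tendsto (fun n => b 0 + ∑ k ∈ range n, f k) atTop (𝓝 (b 0 + ∑' k, f k)) :=
      tendsto_const_nhds.add h
    exact h'.congr fun n => (htel n).symm
  · intro n
    have hsplit := hsf.sum_add_tsum_nat_add n
    have hdiff : b n / s ^ n - L = -∑' k, f (k + n) := by rw [htel n, hL, ← hsplit]; ring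
    have hsfn : Summable (fun k : ℕ => ‖f (k + n)‖) :=
      (hsf.comp_injective (add_left_injective n)).norm
    have hsdn : Summable (fun i : ℕ => Γ / ‖s‖ * ((((i + n : ℕ) : ℝ) + 1) * θ ^ (i + n))) :=
      ((Literature.Analysis.summable_coe_add_one_mul_geometric hθ0 hθ1).comp_injective (add_left_injective n)).mul_left _
    have htail : ‖∑' k, f (k + n)‖ ≤ Γ / ‖s‖ * (((n : ℝ) + 1) * θ ^ n / (1 - θ) ^ 2) := by
      calc ‖∑' k, f (k + n)‖ ≤ ∑' k, ‖f (k + n)‖ := norm_tsum_le_tsum_norm hsfn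
        _ ≤ ∑' i : ℕ, Γ / ‖s‖ * ((((i + n : ℕ) : ℝ) + 1) * θ ^ (i + n)) :=
            Summable.tsum_le_tsum (fun i => hdom (i + n)) hsfn hsdn
        _ = Γ / ‖s‖ * ∑' i : ℕ, ((((i + n : ℕ) : ℝ) + 1) * θ ^ (i + n)) := tsum_mul_left
        _ ≤ Γ / ‖s‖ * (((n : ℝ) + 1) * θ ^ n / (1 - θ) ^ 2) := by
            gcongr
            exact Literature.Analysis.tsum_tail_coe_add_one_mul_geometric_le hθ0 hθ1 n
    -- conclude
    have hsn : 0 < ‖s‖ ^ n := pow_pos hs n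
    have hsn0 : s ^ n ≠ 0 := pow_ne_zero n hs0
    have hkey : ‖b n - L * s ^ n‖ = ‖s‖ ^ n * ‖b n / s ^ n - L‖ := by
      have e : b n - L * s ^ n = s ^ n * (b n / s ^ n - L) := by field_simp
      rw [e, norm_mul, norm_pow]
    rw [hkey, hdiff, norm_neg]
    have hθn : ‖s‖ ^ n * θ ^ n = R ^ n := by
      rw [hθ, div_pow, mul_div_assoc', mul_comm, mul_div_assoc, div_self hsn.ne', mul_one]
    have hsR : (‖s‖ - R) ≠ 0 := by linarith
    have h1θ : ‖s‖ * (1 - θ) ^ 2 = (‖s‖ - R) ^ 2 / ‖s‖ := by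
      rw [hθ, eq_div_iff hs.ne']
      field_simp
    have hfac : 1 / (‖s‖ * (1 - θ) ^ 2) = ‖s‖ / (‖s‖ - R) ^ 2 := by
      rw [h1θ, one_div_div]
    have hΓ' : Γ = ‖b 1 - s * b 0‖ + ‖b 2 - s * b 1‖ / R := by simp only [hΓ, hg]
    calc ‖s‖ ^ n * ‖∑' k, f (k + n)‖ ≤ ‖s‖ ^ n * (Γ / ‖s‖ * (((n : ℝ) + 1) * θ ^ n / (1 - θ) ^ 2)) := by gcongr
      _ = Γ * ((n : ℝ) + 1) * (‖s‖ ^ n * θ ^ n) * (1 / (‖s‖ * (1 - θ) ^ 2)) := by rw [one_div, mul_inv]; ring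
      _ = (‖b 1 - s * b 0‖ + ‖b 2 - s * b 1‖ / R) * ((n : ℝ) + 1) * R ^ n * (‖s‖ / (‖s‖ - R) ^ 2) := by
          rw [hθn, hfac, hΓ']

/-! ## §4 The double-root companion, complex form -/

/-- **The double-root case, complex form**: `f_{n+2} = 2w f_{n+1} − w² f_n` with `w ∈ ℂ`, `w ≠ 0` ⇒
`‖f_n‖ ≤ (n+1)·‖w‖ⁿ·(‖f₀‖ + ‖f₁‖/‖w‖)`. [cite: Stanley2012EC1, §4.1 Theorem 4.1.1 (iii) (lane tool)] -/
theorem norm_le_of_rec_two_double_root_complex {w : ℂ} (hw : w ≠ 0) {f : ℕ → ℂ}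
    (hf : ∀ n, f (n + 2) = 2 * w * f (n + 1) - w ^ 2 * f n) (n : ℕ) :
    ‖f n‖ ≤ ((n : ℝ) + 1) * ‖w‖ ^ n * (‖f 0‖ + ‖f 1‖ / ‖w‖) := by
  have hw0 : 0 < ‖w‖ := norm_pos_iff.2 hw
  have hroot : ∀ σ : ℂ, σ ^ 2 + (-(2 * w)) * σ + w ^ 2 = 0 → ‖σ‖ ≤ ‖w‖ := by
    intro σ hσ
    have h : (σ - w) ^ 2 = 0 := by linear_combination hσ
    have : σ = w := by simpa [sub_eq_zero] using pow_eq_zero_iff (n := 2) (by norm_num) |>.1 h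
    rw [this]
  have hf' : ∀ n, f (n + 2) = -(-(2 * w)) * f (n + 1) - w ^ 2 * f n := by intro n; rw [hf n]; ring
  cases n with
  | zero =>
    simp only [CharP.cast_eq_zero, zero_add, pow_zero, one_mul]
    have : 0 ≤ ‖f 1‖ / ‖w‖ := by positivity
    linarith [norm_nonneg (f 0)]
  | succ n =>
    have h := norm_le_of_rec_two_complex hw0.le hroot hf' n
    have hwn : 0 ≤ ‖w‖ ^ n := pow_nonneg hw0.le n
    have hn0 : (0 : ℝ) ≤ n := n.cast_nonneg
    have e : ((((n + 1 : ℕ) : ℝ)) + 1) * ‖w‖ ^ (n + 1) * (‖f 0‖ + ‖f 1‖ / ‖w‖)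
        = (n + 2) * ‖w‖ ^ (n + 1) * ‖f 0‖ + (n + 2) * ‖w‖ ^ n * ‖f 1‖ := by
      push_cast; field_simp; ring
    rw [e]
    calc ‖f (n + 1)‖ ≤ ‖w‖ ^ (n + 1) * ‖f 0‖ + ((n : ℝ) + 1) * ‖w‖ ^ n * (‖f 1‖ + ‖w‖ * ‖f 0‖) := h
      _ ≤ (n + 2) * ‖w‖ ^ (n + 1) * ‖f 0‖ + (n + 2) * ‖w‖ ^ n * ‖f 1‖ := by
        rw [pow_succ]
        nlinarith [norm_nonneg (f 0), norm_nonneg (f 1), mul_nonneg hwn (norm_nonneg (f 1)),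
          mul_nonneg (mul_nonneg hwn hw0.le) (norm_nonneg (f 0))]

end Literature.Analysis.Asymptotics

end
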